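import Summits.ValiantsHypothesis.ValiantsHypothesis.Theorems.LacunarySymmetroidMatrixDescartesDoorA26WallBubblingMomentTail
import Summits.ValiantsHypothesis.ValiantsHypothesis.Theorems.LacunarySymmetroidMatrixDescartesDoorA26WallBubblingWeylTripleMoments

/-!
# Wall bubbling for `DoorA26` — MERGING BLOCKS OF ANY SIZE: frame moments, the Gram form of the class moments, and the FRAME TAIL (no explicit Newton polynomials)

HONEST FRAMING.  Chain lemmas toward `TripleStratum26` of `Cruxes/DoorA26/Lines/wall_bubbling_ConfluentDoor.lean` (rev 13; crux `DoorA26`,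
stmt-ValiantsHypothesis-19979 — OPEN, typed, never asserted).  W1 seat val-sym-door-p2 g15 (#92).  `TripleStratum26` also covers the patterns
[4,1,1], [4,2], [5,1] (a QUADRUPLE / QUINTUPLE of coinciding exponents); #84 wrote the class moments of a TRIPLE in frame language with EXPLICIT
Newton polynomials (`tripleMoment_three/four/five`).  This file is the size-free version for a block of `n` merging letters `V : ι → M₂(ℝ)` with
deviations `x : ι → ℝ`, frame moments `T_m = Σ_p x_p^m V_p`, polar Gram `G_ij = polar(T_i,T_j)`:

* `blockMoment_eq_frame` — `Σ_{p,q} polar(V_p,V_q)(x_p+x_q)^m = Σ_{i≤m} C(m,i)·polar(T_i, T_{m−i})` (#84's `tripleMoment_eq_frame` for any index type);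
* `blockMixedMoment_eq_frame` — `Σ_q polar(Y,V_q) x_q^m = polar(Y, T_m)`;
* **`frame_pairing_tail`** — THE FRAME TAIL: for every `n` a constant `C ≥ 0` with `|polar(Y, T_m)| ≤ C·w·Σ_{j<n} |polar(Y, T_j)|` for all `m ≥ n`,
  all symmetric-or-not `Y`, whenever the block has `≤ n` letters and `|x_p| ≤ w ≤ 1/2` — #81 `momentTail` applied to the scalar family
  `a_q = polar(Y, V_q)`.  Consequences: every Gram entry with an index `≥ n` is `O(w)·max_{i,j<n}|G_ij|` (`frame_gram_tail`, `frame_gram_tail₂`),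
  so the class moment `M_m` equals its HEAD `Σ_{i+j=m, i,j<n} C(m,i)G_ij` up to `O(w)·maxG` (`blockMoment_head`), and in particular the TOP function-level
  slots `m > 2n − 2` are `O(w)·maxG` outright — the size-free form of #84's «`M₅` carries e-factors only», the entry point of the rigidity dichotomy
  (#88) for blocks of four and five letters.

Nothing here bears on `DoorA26`, `MatrixDescartes` (stmt-ValiantsHypothesis-18050) or `VP ≠ VNP`; `TripleStratum26`, (W), (M) OPEN.
`--supports stmt-ValiantsHypothesis-19979 --as helper`.  [folklore] Newton reduction; [this work] its invariant (Gram) bookkeeping.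
-/

-- `Summit.ValiantsHypothesis.ValiantsHypothesis.…` repeats a component by the D-0017 layout
-- (single-conjunct summit), which the `dupNamespace` linter flags; the name is mandated.
set_option linter.dupNamespace false

namespace Summit.ValiantsHypothesis.ValiantsHypothesis.Theorems.LacunarySymmetroidMatrixDescartes.WallBubbling

open Finset
open Bubbling (polar polar_apply)
open scoped BigOperators

/-! ## 1. Class moments of a block in frame language (any index type) -/

/-- **`M_m = Σ_{i≤m} C(m,i)·polar(T_i,T_{m−i})`** for a block indexed by any finite type. [this work] -/
theorem blockMoment_eq_frame {ι : Type*} [Fintype ι] (V : ι → Matrix (Fin 2) (Fin 2) ℝ) (x : ι → ℝ) (m : ℕ) :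
    ∑ p, ∑ q, polar (V p) (V q) * (x p + x q) ^ m
      = ∑ i ∈ Finset.range (m + 1), (m.choose i : ℝ) * polar (∑ p, x p ^ i • V p) (∑ q, x q ^ (m - i) • V q) := by
  simp only [polarFrame_sum_smul_sum_smul]
  rw [eq_comm]
  calc ∑ i ∈ Finset.range (m + 1), (m.choose i : ℝ) * ∑ p, ∑ q, x p ^ i * x q ^ (m - i) * polar (V p) (V q)
      = ∑ i ∈ Finset.range (m + 1), ∑ p, ∑ q, (m.choose i : ℝ) * (x p ^ i * x q ^ (m - i) * polar (V p) (V q)) := by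
        simp only [Finset.mul_sum]
    _ = ∑ p, ∑ i ∈ Finset.range (m + 1), ∑ q, (m.choose i : ℝ) * (x p ^ i * x q ^ (m - i) * polar (V p) (V q)) :=
        Finset.sum_comm
    _ = ∑ p, ∑ q, ∑ i ∈ Finset.range (m + 1), (m.choose i : ℝ) * (x p ^ i * x q ^ (m - i) * polar (V p) (V q)) :=
        Finset.sum_congr rfl fun p _ => Finset.sum_comm
    _ = ∑ p, ∑ q, polar (V p) (V q) * (x p + x q) ^ m := by
        refine Finset.sum_congr rfl fun p _ => Finset.sum_congr rfl fun q _ => ?_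
        rw [add_pow, Finset.mul_sum]
        exact Finset.sum_congr rfl fun i _ => by ring

/-- **Mixed moments**: `Σ_q polar(Y,V_q)·x_q^m = polar(Y, T_m)` (any index type). [this work] -/
theorem blockMixedMoment_eq_frame {ι : Type*} [Fintype ι] (Y : Matrix (Fin 2) (Fin 2) ℝ) (V : ι → Matrix (Fin 2) (Fin 2) ℝ)
    (x : ι → ℝ) (m : ℕ) : ∑ q, polar Y (V q) * x q ^ m = polar Y (∑ q, x q ^ m • V q) := by
  rw [Bubbling.polar_comm, polarFrame_sum_smul_left]
  refine Finset.sum_congr rfl fun q _ => ?_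
  rw [Bubbling.polar_comm]; ring

/-! ## 2. The frame tail -/

/-- **THE FRAME TAIL.**  For every `n` there is `C ≥ 0`: a block with at most `n` letters and deviations `|x_p| ≤ w ≤ 1/2` has
`|polar(Y, T_m)| ≤ C · w · Σ_{j<n} |polar(Y, T_j)|` for every `m ≥ n` and every `Y`. [this work] -/
theorem frame_pairing_tail (n : ℕ) : ∃ C : ℝ, 0 ≤ C ∧ ∀ {ι : Type*} [Fintype ι] [DecidableEq ι], Fintype.card ι ≤ n →
    ∀ (V : ι → Matrix (Fin 2) (Fin 2) ℝ) (x : ι → ℝ) (w : ℝ), 0 ≤ w → w ≤ 1 / 2 → (∀ p, |x p| ≤ w) →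
    ∀ (Y : Matrix (Fin 2) (Fin 2) ℝ) (m : ℕ), n ≤ m →
      |polar Y (∑ q, x q ^ m • V q)| ≤ C * w * ∑ j ∈ Finset.range n, |polar Y (∑ q, x q ^ j • V q)| := by
  obtain ⟨C, hC0, hC⟩ := momentTail n
  refine ⟨C, hC0, ?_⟩
  intro ι _ _ hcard V x w hw0 hw1 hx Y m hm
  have h := hC (Finset.univ : Finset ι) (by rwa [Finset.card_univ]) (fun q => polar Y (V q)) x w hw0 hw1 (fun p _ => hx p) m hm
  simp only [blockMixedMoment_eq_frame] at h
  exact h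

/-- **Gram entries with one index beyond the block size**: `|polar(T_i, T_m)| ≤ C·w·Σ_{j<n}|polar(T_i,T_j)|` (`m ≥ n`, any `i`). [this work] -/
theorem frame_gram_tail (n : ℕ) : ∃ C : ℝ, 0 ≤ C ∧ ∀ {ι : Type*} [Fintype ι] [DecidableEq ι], Fintype.card ι ≤ n →
    ∀ (V : ι → Matrix (Fin 2) (Fin 2) ℝ) (x : ι → ℝ) (w : ℝ), 0 ≤ w → w ≤ 1 / 2 → (∀ p, |x p| ≤ w) →
    ∀ (i m : ℕ), n ≤ m →
      |polar (∑ q, x q ^ i • V q) (∑ q, x q ^ m • V q)|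
        ≤ C * w * ∑ j ∈ Finset.range n, |polar (∑ q, x q ^ i • V q) (∑ q, x q ^ j • V q)| := by
  obtain ⟨C, hC0, hC⟩ := frame_pairing_tail n
  exact ⟨C, hC0, fun hcard V x w hw0 hw1 hx i m hm => hC hcard V x w hw0 hw1 hx _ m hm⟩

/-- **Head entries bound everything**: with `g ≥ |polar(T_i,T_j)|` for `i, j < n` (`g ≥ 0`), EVERY `|polar(T_i,T_m)|` with `m ≥ n` is at
most `C′·w·g`. [this work] -/
theorem frame_gram_tail₂ (n : ℕ) : ∃ C : ℝ, 0 ≤ C ∧ ∀ {ι : Type*} [Fintype ι] [DecidableEq ι], Fintype.card ι ≤ n →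
    ∀ (V : ι → Matrix (Fin 2) (Fin 2) ℝ) (x : ι → ℝ) (w : ℝ), 0 ≤ w → w ≤ 1 / 2 → (∀ p, |x p| ≤ w) →
    ∀ (g : ℝ), 0 ≤ g → (∀ i j : ℕ, i < n → j < n → |polar (∑ q, x q ^ i • V q) (∑ q, x q ^ j • V q)| ≤ g) →
    ∀ (i m : ℕ), n ≤ m → |polar (∑ q, x q ^ i • V q) (∑ q, x q ^ m • V q)| ≤ C * w * g := by
  obtain ⟨C, hC0, hC⟩ := frame_gram_tail n
  refine ⟨C * n * (1 + C * n), by positivity, ?_⟩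
  intro ι _ _ hcard V x w hw0 hw1 hx g hg0 hg i m hm
  have hCn : 0 ≤ C * n := by positivity
  -- head rows against any column
  have hrow : ∀ i : ℕ, i < n → ∀ m : ℕ, |polar (∑ q, x q ^ i • V q) (∑ q, x q ^ m • V q)| ≤ (1 + C * n) * g := by
    intro i hi m
    by_cases hmn : m < n
    · calc |polar (∑ q, x q ^ i • V q) (∑ q, x q ^ m • V q)| ≤ g := hg i m hi hmn
        _ = 1 * g := (one_mul g).symm
        _ ≤ (1 + C * n) * g := mul_le_mul_of_nonneg_right (by linarith) hg0
    · have h := hC hcard V x w hw0 hw1 hx i m (not_lt.mp hmn)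
      have hsum : ∑ j ∈ Finset.range n, |polar (∑ q, x q ^ i • V q) (∑ q, x q ^ j • V q)| ≤ n * g := by
        calc ∑ j ∈ Finset.range n, |polar (∑ q, x q ^ i • V q) (∑ q, x q ^ j • V q)| ≤ ∑ _j ∈ Finset.range n, g :=
              Finset.sum_le_sum fun j hj => hg i j hi (Finset.mem_range.mp hj)
          _ = n * g := by rw [Finset.sum_const, Finset.card_range, nsmul_eq_mul]
      calc |polar (∑ q, x q ^ i • V q) (∑ q, x q ^ m • V q)|
          ≤ C * w * ∑ j ∈ Finset.range n, |polar (∑ q, x q ^ i • V q) (∑ q, x q ^ j • V q)| := h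
        _ ≤ C * w * (n * g) := mul_le_mul_of_nonneg_left hsum (mul_nonneg hC0 hw0)
        _ ≤ C * 1 * (n * g) := by gcongr; linarith
        _ ≤ (1 + C * n) * g := by nlinarith
  -- any row against a column `m ≥ n`
  have h := hC hcard V x w hw0 hw1 hx i m hm
  have hsum : ∑ j ∈ Finset.range n, |polar (∑ q, x q ^ i • V q) (∑ q, x q ^ j • V q)| ≤ n * ((1 + C * n) * g) := by
    calc ∑ j ∈ Finset.range n, |polar (∑ q, x q ^ i • V q) (∑ q, x q ^ j • V q)| ≤ ∑ _j ∈ Finset.range n, (1 + C * n) * g := by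
          refine Finset.sum_le_sum fun j hj => ?_
          rw [Bubbling.polar_comm]; exact hrow j (Finset.mem_range.mp hj) i
      _ = n * ((1 + C * n) * g) := by rw [Finset.sum_const, Finset.card_range, nsmul_eq_mul]
  calc |polar (∑ q, x q ^ i • V q) (∑ q, x q ^ m • V q)|
      ≤ C * w * ∑ j ∈ Finset.range n, |polar (∑ q, x q ^ i • V q) (∑ q, x q ^ j • V q)| := h
    _ ≤ C * w * (n * ((1 + C * n) * g)) := mul_le_mul_of_nonneg_left hsum (mul_nonneg hC0 hw0)
    _ = C * n * (1 + C * n) * w * g := by ring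

/-! ## 3. The class moment equals its head up to `O(w)·maxG` -/

/-- **HEAD DECOMPOSITION.**  `|M_m − Σ_{i<n, m−i<n} C(m,i)·G_{i,m−i}| ≤ C·2^m·w·g` where `g` bounds the head Gram entries. [this work] -/
theorem blockMoment_head (n : ℕ) : ∃ C : ℝ, 0 ≤ C ∧ ∀ {ι : Type*} [Fintype ι] [DecidableEq ι], Fintype.card ι ≤ n →
    ∀ (V : ι → Matrix (Fin 2) (Fin 2) ℝ) (x : ι → ℝ) (w : ℝ), 0 ≤ w → w ≤ 1 / 2 → (∀ p, |x p| ≤ w) →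
    ∀ (g : ℝ), 0 ≤ g → (∀ i j : ℕ, i < n → j < n → |polar (∑ q, x q ^ i • V q) (∑ q, x q ^ j • V q)| ≤ g) →
    ∀ (m : ℕ), |∑ p, ∑ q, polar (V p) (V q) * (x p + x q) ^ m
        - ∑ i ∈ (Finset.range (m + 1)).filter (fun i => i < n ∧ m - i < n),
            (m.choose i : ℝ) * polar (∑ q, x q ^ i • V q) (∑ q, x q ^ (m - i) • V q)| ≤ C * 2 ^ m * w * g := by
  obtain ⟨C, hC0, hC⟩ := frame_gram_tail₂ n
  refine ⟨C, hC0, ?_⟩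
  intro ι _ _ hcard V x w hw0 hw1 hx g hg0' hg m
  have hg0 : 0 ≤ C * w * g := by positivity
  rw [blockMoment_eq_frame, ← Finset.sum_filter_add_sum_filter_not (Finset.range (m + 1)) (fun i => i < n ∧ m - i < n), add_sub_cancel_left]
  calc |∑ i ∈ (Finset.range (m + 1)).filter (fun i => ¬(i < n ∧ m - i < n)),
          (m.choose i : ℝ) * polar (∑ q, x q ^ i • V q) (∑ q, x q ^ (m - i) • V q)|
      ≤ ∑ i ∈ (Finset.range (m + 1)).filter (fun i => ¬(i < n ∧ m - i < n)),
          |(m.choose i : ℝ) * polar (∑ q, x q ^ i • V q) (∑ q, x q ^ (m - i) • V q)| := Finset.abs_sum_le_sum_abs _ _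
    _ ≤ ∑ i ∈ (Finset.range (m + 1)).filter (fun i => ¬(i < n ∧ m - i < n)), (m.choose i : ℝ) * (C * w * g) := by
        refine Finset.sum_le_sum fun i hi => ?_
        rw [abs_mul, Nat.abs_cast]
        refine mul_le_mul_of_nonneg_left ?_ (Nat.cast_nonneg _)
        have hi' := (Finset.mem_filter.mp hi).2
        by_cases h1 : i < n
        · have h2 : n ≤ m - i := not_lt.mp fun h => hi' ⟨h1, h⟩
          exact hC hcard V x w hw0 hw1 hx g hg0' hg i (m - i) h2
        · rw [Bubbling.polar_comm]
          exact hC hcard V x w hw0 hw1 hx g hg0' hg (m - i) i (not_lt.mp h1)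
    _ ≤ ∑ i ∈ Finset.range (m + 1), (m.choose i : ℝ) * (C * w * g) :=
        Finset.sum_le_sum_of_subset_of_nonneg (Finset.filter_subset _ _) fun i _ _ => mul_nonneg (Nat.cast_nonneg _) hg0
    _ = 2 ^ m * (C * w * g) := by
        rw [← Finset.sum_mul]
        congr 1
        have := (Nat.sum_range_choose m)
        exact_mod_cast this
    _ = C * 2 ^ m * w * g := by ring

end Summit.ValiantsHypothesis.ValiantsHypothesis.Theorems.LacunarySymmetroidMatrixDescartes.WallBubbling
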